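import Summits.Ventures.LatticeQCDFlow.Scaling.HubChainStartContentCover

/-!
HONEST FRAMING: exact (Metropolis-corrected) sampling algorithms for lattice gauge theory; figures
of merit are autocorrelation/cost numbers at stated couplings and volumes; no continuum-physics
claim.

# HubChainStartContentCoverPair — THE COVER IN THE RESIDUAL CONFIGURATION: THE TAG AND THE START CLASS ARE THE TWO SHALLOWEST CLASSES, ONE PARTICLE EACH (RANKS `0, 1`), WHERE
# `T_n(1)` IS NOT ANTITONE IN `ρ_0` — STILL `P_Yⁿ(1,1) ≤ P_Xⁿ(1,1) + P_Xⁿ(1,0)` FOR EVERY `n`, BY TWO EXACT IDENTITIES AT THE LEVELS `a_0 = 0`, `a_1 = c` (lean-2 GEN-40, ours)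

Venture-side (OURS).  Cell `lqcd-flow` (pub-lqcd), unit `pub-lqcd-lean-2-g40`, 2026-08-30.  Chapter Z, file 7.  Z6 `startClass_cover` needs three particles at ranks `≤ i` (the particle
condition of Z2, under which `T_n(i)` is antitone in the tag's depth).  The one configuration of an adjacent pair it misses: the tag at rank `0`, the start class at rank `1`, both single
particles (`N_0 = N_1 = 1`) — the `{0,1}` pair of MEMO-gen40 §2 where `T_n(1)` is NOT antitone in `ρ_0` (toy: ≈ 9 % of such states).  With the star's normalisation `cM_0 = 1 + c` the
levels there are `a_0 = 0`, `a_1 = c`, the eigenvalues `β^X_1 = −r` (`r = cρ^X_0/ρ_1`, the tag's share), `β^Y_1 = −(r+d)` with `r + d ≤ c`, `β^X_0 = −c`, and the two tag estimates of Z6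
become identities plus one scalar fact:
* `coverB_scalar`: `c·H_n(−e,c) ≤ cⁿ` for `0 ≤ e ≤ c` (parity); `sepH_zero_right` (`H_n(x,0) = xⁿ⁻¹`); `coverB_T_ge_two` (the separable form with TWO leading terms kept);
* `coverB_levels` (`a_0 = 0`, `a_1 = c`, `β^X_1 = −r`, `β^Y_1 = −(r+d)`, `β^X_0 = −c`);
* `coverB_I`: `P_Yⁿ(0,1) ≤ P_Xⁿ(1,1) + P_Xⁿ(1,0)` — since `(c+r)H_n(−r,c) = cⁿ − (−r)ⁿ`, the three rank-`1` contributions sum to EXACTLY `cⁿ − cH_n(β^Y_1,c) ≥ 0`;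
* `coverB_II`: `P_Yⁿ(0,1) ≤ P_Xⁿ(0,1) + P_Xⁿ(0,0)` — here `P_Xⁿ(0,0)` is needed (not just `≥ 0`): its two leading terms give `c(−c)ⁿ⁻¹ + (−c)ⁿ = 0` and `r[H_n(−r,c) − (−r)ⁿ⁻¹]`, and the
  total is again EXACTLY `cⁿ − cH_n(β^Y_1,c) ≥ 0`;
* **`startClass_cover_pair`**: `P_Yⁿ(1,1) ≤ P_Xⁿ(1,1) + P_Xⁿ(1,0)` for every `n` (Z6 `startClass_cover_of` with M′ at the deeper classes, which satisfy the particle condition).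
Together with Z6: for EVERY adjacent pair whose tags are not separated by another class, the per-step start-content deficit is at most `x_j(★)`.  TOY (`numerics/regimeB.py`, exact
rationals, NOTHING CLAIMED): 0 ∕ 7 490 violations of `(I)`, `(II)` and the cover in this configuration, while `T^Y_n(1) ≤ T^X_n(1)` fails in 672 of them.
Literature grade (cell rule): OWN, elementary; nothing cited; no new bib keys.
-/

open Finset

namespace Summit.Ventures.LatticeQCDFlow.Scaling

/-! ### §1 Scalar facts -/
section PairScalar
variable {H : ℕ → ℝ → ℝ → ℝ}

/-- `H_n(x,0) = xⁿ⁻¹` for `n ≥ 1`. [ours] -/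
theorem sepH_zero_right (hH : ∀ n x y, H n x y = ∑ t ∈ range n, x ^ t * y ^ (n - 1 - t)) {n : ℕ} (hn : 1 ≤ n) (x : ℝ) : H n x 0 = x ^ (n - 1) := by
  rw [hH, Finset.sum_eq_single (n - 1)]
  · rw [Nat.sub_self, pow_zero, mul_one]
  · intro t ht htn
    have : t < n := mem_range.mp ht
    rw [zero_pow (by omega), mul_zero]
  · intro h; exact absurd (mem_range.mpr (by omega)) h

/-- **`c·H_n(−e,c) ≤ cⁿ` for `0 ≤ e ≤ c`, `0 < c`** (from `(c+e)H_n(−e,c) = cⁿ − (−e)ⁿ`, by parity). [ours] -/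
theorem coverB_scalar (hH : ∀ n x y, H n x y = ∑ t ∈ range n, x ^ t * y ^ (n - 1 - t)) (n : ℕ) {c e : ℝ} (hc : 0 < c) (he : 0 ≤ e) (hec : e ≤ c) :
    c * H n (-e) c ≤ c ^ n := by
  have hmul := hubChain_H_mul hH n (-e) c
  -- `(c + e)·H = cⁿ − (−e)ⁿ`
  have key : (c + e) * H n (-e) c = c ^ n - (-e) ^ n := by linear_combination (-1 : ℝ) * hmul
  have hce : 0 < c + e := by linarith
  -- `−c(−e)ⁿ ≤ e·cⁿ`
  have hpar : -(c * (-e) ^ n) ≤ e * c ^ n := by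
    rcases Nat.even_or_odd n with hev | hod
    · rw [hev.neg_pow]; nlinarith [pow_nonneg he n, pow_nonneg hc.le n]
    · rw [hod.neg_pow]
      obtain ⟨k, hk⟩ := hod
      have hn1 : n - 1 + 1 = n := by omega
      have h1 : e ^ n = e * e ^ (n - 1) := by rw [← pow_succ', hn1]
      have h2 : c ^ n = c * c ^ (n - 1) := by rw [← pow_succ', hn1]
      have h3 : e ^ (n - 1) ≤ c ^ (n - 1) := pow_le_pow_left₀ he hec _
      rw [h1, h2]
      nlinarith [mul_le_mul_of_nonneg_left h3 he, pow_nonneg he (n - 1)]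
  -- `cH(c+e) = c(cⁿ − (−e)ⁿ) ≤ (c+e)cⁿ`
  have : c * H n (-e) c * (c + e) ≤ c ^ n * (c + e) := by nlinarith [key]
  exact le_of_mul_le_mul_right this hce

end PairScalar

/-! ### §2 The separable form with two leading terms -/
section PairSep
variable {m : ℕ} {ρ N R M β a : ℕ → ℝ} {c : ℝ} {T : ℕ → ℕ → ℝ} {H : ℕ → ℝ → ℝ → ℝ}

/-- `T_n(j) ≥ c(1/ρ_j)H_n(β_j,a_j) + c(1/ρ_{j+1})[H_n(β_{j+1},a_{j+1}) − H_n(β_{j+1},a_j)]` (`j+1 < m`, `a_{j+1} ≥ 0`, three particles at ranks `≤ j+2`). [ours] -/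
theorem coverB_T_ge_two (hρ : ∀ i, 0 < ρ i) (hmono : Monotone ρ) (hN : ∀ i, 0 < N i) (hR : ∀ k, R k = ∑ i ∈ range k, N i * ρ i)
    (hM : ∀ k, M k = ∑ i ∈ Ico k m, N i) (hβ : ∀ k, β k = 1 - c * (M k + R k / ρ k)) (ha : ∀ l, a l = 1 - c * M (l + 1))
    (hT : ∀ n j, T n j = (1 - β j ^ n) / R m + ∑ k ∈ Ico (j + 1) m, (1 / R k - 1 / R (k + 1)) * (β k ^ n - β j ^ n))
    (hH : ∀ n x y, H n x y = ∑ t ∈ range n, x ^ t * y ^ (n - 1 - t))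
    (hc : 0 ≤ c) (hcK : c * M 0 ≤ 1 + c) (n : ℕ) {j : ℕ} (hj : j + 1 < m) (ha1 : 0 ≤ a (j + 1)) (h3 : M (j + 3) + 3 ≤ M 0) :
    c * (1 / ρ j) * H n (β j) (a j) + c * ((1 / ρ (j + 1)) * (H n (β (j + 1)) (a (j + 1)) - H n (β (j + 1)) (a j))) ≤ T n j := by
  obtain ⟨G, hG⟩ : ∃ G : ℕ → ℝ → ℝ → ℝ → ℝ, ∀ n a a' b, G n a a' b = ∑ q ∈ range (n - 1), a' ^ q * H (n - 1 - q) b a := ⟨_, fun _ _ _ _ => rfl⟩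
  rw [hubClass_T_separable hρ hN hR hM hβ ha hT hH n (by omega : j < m), Finset.sum_eq_sum_Ico_succ_bot hj, show j + 1 - 1 = j by omega, mul_add]
  have hal : ∀ l, j + 2 ≤ l → 2 * c ≤ a l := fun l hjl => perStep_level hN hM ha hc hcK h3 hjl
  have hapos : ∀ l, j + 2 ≤ l → 0 < a l := by
    intro l hjl
    have := hal l hjl
    rcases hc.eq_or_lt with h0 | hpos; · rw [ha, ← h0]; norm_num
    linarith
  have hann : ∀ l, j + 1 ≤ l → 0 ≤ a l := by
    intro l hjl
    rcases Nat.eq_or_lt_of_le hjl with h | h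
    · rw [← h]; exact ha1
    · linarith [hal l (by omega)]
  have hsum : 0 ≤ ∑ l ∈ Ico (j + 1 + 1) m, (1 / ρ l) * (H n (β l) (a l) - H n (β l) (a (l - 1))) := by
    refine sum_nonneg fun l hl => ?_
    obtain ⟨hl1, hl2⟩ := mem_Ico.mp hl
    rw [← sepG_mul hH hG n (a l) (a (l - 1)) (β l), sep_a_step hM ha (by omega) hl2]
    exact mul_nonneg (div_nonneg zero_le_one (hρ l).le) (mul_nonneg (mul_nonneg hc (hN l).le)
      (sepG_nonneg hH hG n (hapos l (by omega)) (hann (l - 1) (by omega)) (perStep_beta_level hρ hmono hN hR hM hβ ha hc hcK h3 (by omega) hl2)))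
  nlinarith [mul_nonneg hc hsum]

end PairSep

/-! ### §3 The residual configuration: tag at rank `0`, start class at rank `1`, one particle each -/
section Pair
variable {m : ℕ} {ρX ρY N RX RY M βX βY a : ℕ → ℝ} {c : ℝ} {PX PY fX fY : ℕ → ℕ → ℝ} {PnX PnY : ℕ → ℕ → ℕ → ℝ} {TX TY : ℕ → ℕ → ℝ}

/-- **The levels and eigenvalues of the residual configuration:** `a_0 = 0`, `a_1 = c`, `β^X_1 = −cρ^X_0/ρ_1`, `β^Y_1 = −cρ^Y_0/ρ_1`, `β^X_0 = −c`, and `cρ^Y_0/ρ_1 ≤ c`. [ours] -/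
theorem coverB_levels (hρY : ∀ i, 0 < ρY i) (hmonoY : Monotone ρY) (hagree : ∀ i, i ≠ 0 → ρX i = ρY i)
    (hRX : ∀ k, RX k = ∑ i ∈ range k, N i * ρX i) (hRY : ∀ k, RY k = ∑ i ∈ range k, N i * ρY i) (hM : ∀ k, M k = ∑ i ∈ Ico k m, N i)
    (hβX : ∀ k, βX k = 1 - c * (M k + RX k / ρX k)) (hβY : ∀ k, βY k = 1 - c * (M k + RY k / ρY k)) (ha : ∀ l, a l = 1 - c * M (l + 1))
    (hcK : c * M 0 = 1 + c) (hN0 : N 0 = 1) (hN1 : N 1 = 1) (hm : 1 < m) (hc : 0 ≤ c) :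
    a 0 = 0 ∧ a 1 = c ∧ βX 1 = -(c * ρX 0 / ρX 1) ∧ βY 1 = -(c * ρY 0 / ρX 1) ∧ βX 0 = -c ∧ c * ρY 0 / ρX 1 ≤ c := by
  have hM0 : M 0 = N 0 + M 1 := hubClass_M_succ hM (by omega)
  have hM1 : M 1 = N 1 + M 2 := hubClass_M_succ hM hm
  have hρ1 : ρX 1 = ρY 1 := hagree 1 one_ne_zero
  have hRX1 : RX 1 = ρX 0 := by rw [hRX]; simp [hN0]
  have hRY1 : RY 1 = ρY 0 := by rw [hRY]; simp [hN0]
  have hRX0 : RX 0 = 0 := by rw [hRX]; simp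
  have hcM1 : c * M 1 = 1 := by
    have : c * M 0 = c * N 0 + c * M 1 := by rw [hM0]; ring
    rw [hN0] at this; linarith
  have hcM2 : c * M 2 = 1 - c := by
    have : c * M 1 = c * N 1 + c * M 2 := by rw [hM1]; ring
    rw [hN1] at this; linarith
  refine ⟨?_, ?_, ?_, ?_, ?_, ?_⟩
  · rw [ha, zero_add]; linarith
  · rw [ha, show (1:ℕ) + 1 = 2 from rfl]; linarith
  · rw [hβX, hRX1, mul_add, ← mul_div_assoc]; linarith
  · rw [hβY, hRY1, ← hρ1, mul_add, ← mul_div_assoc]; linarith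
  · rw [hβX, hRX0, zero_div, add_zero]; linarith
  · rw [hρ1, mul_div_assoc]
    have h := hmonoY (zero_le_one : (0:ℕ) ≤ 1)
    have : ρY 0 / ρY 1 ≤ 1 := (div_le_one (hρY 1)).mpr h
    exact mul_le_of_le_one_right hc this

/-- **(I) in the residual configuration:** `P_Yⁿ(0,1) ≤ P_Xⁿ(1,1) + P_Xⁿ(1,0)`. [ours] -/
theorem coverB_I (hρX : ∀ i, 0 < ρX i) (hmonoX : Monotone ρX) (hρY : ∀ i, 0 < ρY i) (hmonoY : Monotone ρY)
    (hagree : ∀ i, i ≠ 0 → ρX i = ρY i) (htag : ρX 0 ≤ ρY 0) (hN : ∀ i, 0 < N i)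
    (hRX : ∀ k, RX k = ∑ i ∈ range k, N i * ρX i) (hRY : ∀ k, RY k = ∑ i ∈ range k, N i * ρY i) (hM : ∀ k, M k = ∑ i ∈ Ico k m, N i)
    (hPXoff : ∀ i j, i ≠ j → PX i j = c * N j * min 1 (ρX j / ρX i)) (hPXdiag : ∀ i, PX i i = 1 - ∑ j ∈ (range m).erase i, PX i j)
    (hPYoff : ∀ i j, i ≠ j → PY i j = c * N j * min 1 (ρY j / ρY i)) (hPYdiag : ∀ i, PY i i = 1 - ∑ j ∈ (range m).erase i, PY i j)
    (hfX : ∀ k i, fX k i = if i < k then ρX k else if i = k then -(RX k / N k) else 0)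
    (hfY : ∀ k i, fY k i = if i < k then ρY k else if i = k then -(RY k / N k) else 0)
    (hβX : ∀ k, βX k = 1 - c * (M k + RX k / ρX k)) (hβY : ∀ k, βY k = 1 - c * (M k + RY k / ρY k)) (ha : ∀ l, a l = 1 - c * M (l + 1))
    (hPX0 : ∀ i j, PnX 0 i j = if i = j then 1 else 0) (hPXs : ∀ n i j, PnX (n + 1) i j = ∑ l ∈ range m, PnX n i l * PX l j)
    (hPY0 : ∀ i j, PnY 0 i j = if i = j then 1 else 0) (hPYs : ∀ n i j, PnY (n + 1) i j = ∑ l ∈ range m, PnY n i l * PY l j)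
    (hTX : ∀ n j, TX n j = (1 - βX j ^ n) / RX m + ∑ k ∈ Ico (j + 1) m, (1 / RX k - 1 / RX (k + 1)) * (βX k ^ n - βX j ^ n))
    (hTY : ∀ n j, TY n j = (1 - βY j ^ n) / RY m + ∑ k ∈ Ico (j + 1) m, (1 / RY k - 1 / RY (k + 1)) * (βY k ^ n - βY j ^ n))
    (hc : 0 < c) (hcK : c * M 0 = 1 + c) (hN0 : N 0 = 1) (hN1 : N 1 = 1) (hm : 1 < m) (h3 : M 3 + 3 ≤ M 0) (n : ℕ) :
    PnY n 0 1 ≤ PnX n 1 1 + PnX n 1 0 := by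
  obtain ⟨H, hH⟩ : ∃ H : ℕ → ℝ → ℝ → ℝ, ∀ n x y, H n x y = ∑ t ∈ range n, x ^ t * y ^ (n - 1 - t) := ⟨_, fun _ _ _ => rfl⟩
  obtain ⟨ha0, ha1, hu, hv, -, hrd⟩ := coverB_levels hρY hmonoY hagree hRX hRY hM hβX hβY ha hcK hN0 hN1 hm hc.le
  rw [hubClass_pow_offdiag hρY hmonoY hN hRY hM hPYoff hPYdiag hfY hβY hPY0 hPYs hTY n (by omega) hm (by omega), max_eq_right zero_le_one, ← hagree 1 one_ne_zero,
    hubClass_pow_diag hρX hmonoX hN hRX hM hPXoff hPXdiag hfX hβX hPX0 hPXs hTX n hm,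
    hubClass_pow_offdiag hρX hmonoX hN hRX hM hPXoff hPXdiag hfX hβX hPX0 hPXs hTX n hm (by omega) (by omega), max_eq_left zero_le_one, hN1, hN0]
  have hsub := cover_T_sub_ge_deep hρX hρY hmonoY hagree htag hN hRX hRY hM hβX hβY ha hTX hTY hH hc.le hcK.le n zero_lt_one hm (by rw [ha1]; exact hc.le) h3
  have hfirst := cover_T_ge_first hρX hmonoX hN hRX hM hβX ha hTX hH hc.le hcK.le n hm (by rw [ha1]; exact hc.le) h3
  rw [ha1] at hsub hfirst
  have hρ1 := hρX 1
  have hρ0 := hρX 0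
  -- the rank-1 contributions: `c[H(u,c) − H(v,c)] + uⁿ + r H(u,c)` with `r = cρ_0/ρ_1 = −u`, `(c + r)H(u,c) = cⁿ − uⁿ`
  have hmul := hubChain_H_mul hH n (βX 1) c
  have key : (c + c * ρX 0 / ρX 1) * H n (βX 1) c = c ^ n - βX 1 ^ n := by rw [hu]; rw [hu] at hmul; linear_combination (-1 : ℝ) * hmul
  have he0 : 0 ≤ c * ρY 0 / ρX 1 := div_nonneg (mul_nonneg hc.le (hρY 0).le) hρ1.le
  have hsc : c * H n (βY 1) c ≤ c ^ n := by rw [hv]; exact coverB_scalar hH n hc he0 hrd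
  have e1 : c * H n (βX 1) c - c * H n (βY 1) c ≤ ρX 1 * TX n 1 - ρX 1 * TY n 1 := by
    have h := mul_le_mul_of_nonneg_left hsub hρ1.le
    have e : ρX 1 * (c * (1 / ρX 1) * (H n (βX 1) c - H n (βY 1) c)) = c * H n (βX 1) c - c * H n (βY 1) c := by field_simp
    rw [e, mul_sub] at h; exact h
  have e2 : c * ρX 0 / ρX 1 * H n (βX 1) c ≤ ρX 0 * TX n 1 := by
    have h := mul_le_mul_of_nonneg_left hfirst hρ0.le
    have e : ρX 0 * (c * (1 / ρX 1) * H n (βX 1) c) = c * ρX 0 / ρX 1 * H n (βX 1) c := by field_simp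
    rw [e] at h; exact h
  have key' : c * H n (βX 1) c + c * ρX 0 / ρX 1 * H n (βX 1) c = c ^ n - βX 1 ^ n := by rw [← key]; ring
  simp only [one_mul]
  linarith [e1, e2, key', hsc]

/-- **(II) in the residual configuration:** `P_Yⁿ(0,1) ≤ P_Xⁿ(0,1) + P_Xⁿ(0,0)` (`P_Xⁿ(0,0)`'s two leading terms are what pays). [ours] -/
theorem coverB_II (hρX : ∀ i, 0 < ρX i) (hmonoX : Monotone ρX) (hρY : ∀ i, 0 < ρY i) (hmonoY : Monotone ρY)
    (hagree : ∀ i, i ≠ 0 → ρX i = ρY i) (htag : ρX 0 ≤ ρY 0) (hN : ∀ i, 0 < N i)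
    (hRX : ∀ k, RX k = ∑ i ∈ range k, N i * ρX i) (hRY : ∀ k, RY k = ∑ i ∈ range k, N i * ρY i) (hM : ∀ k, M k = ∑ i ∈ Ico k m, N i)
    (hPXoff : ∀ i j, i ≠ j → PX i j = c * N j * min 1 (ρX j / ρX i)) (hPXdiag : ∀ i, PX i i = 1 - ∑ j ∈ (range m).erase i, PX i j)
    (hPYoff : ∀ i j, i ≠ j → PY i j = c * N j * min 1 (ρY j / ρY i)) (hPYdiag : ∀ i, PY i i = 1 - ∑ j ∈ (range m).erase i, PY i j)
    (hfX : ∀ k i, fX k i = if i < k then ρX k else if i = k then -(RX k / N k) else 0)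
    (hfY : ∀ k i, fY k i = if i < k then ρY k else if i = k then -(RY k / N k) else 0)
    (hβX : ∀ k, βX k = 1 - c * (M k + RX k / ρX k)) (hβY : ∀ k, βY k = 1 - c * (M k + RY k / ρY k)) (ha : ∀ l, a l = 1 - c * M (l + 1))
    (hPX0 : ∀ i j, PnX 0 i j = if i = j then 1 else 0) (hPXs : ∀ n i j, PnX (n + 1) i j = ∑ l ∈ range m, PnX n i l * PX l j)
    (hPY0 : ∀ i j, PnY 0 i j = if i = j then 1 else 0) (hPYs : ∀ n i j, PnY (n + 1) i j = ∑ l ∈ range m, PnY n i l * PY l j)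
    (hTX : ∀ n j, TX n j = (1 - βX j ^ n) / RX m + ∑ k ∈ Ico (j + 1) m, (1 / RX k - 1 / RX (k + 1)) * (βX k ^ n - βX j ^ n))
    (hTY : ∀ n j, TY n j = (1 - βY j ^ n) / RY m + ∑ k ∈ Ico (j + 1) m, (1 / RY k - 1 / RY (k + 1)) * (βY k ^ n - βY j ^ n))
    (hc : 0 < c) (hcK : c * M 0 = 1 + c) (hN0 : N 0 = 1) (hN1 : N 1 = 1) (hm : 1 < m) (h3 : M 3 + 3 ≤ M 0) (n : ℕ) :
    PnY n 0 1 ≤ PnX n 0 1 + PnX n 0 0 := by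
  obtain ⟨H, hH⟩ : ∃ H : ℕ → ℝ → ℝ → ℝ, ∀ n x y, H n x y = ∑ t ∈ range n, x ^ t * y ^ (n - 1 - t) := ⟨_, fun _ _ _ => rfl⟩
  obtain ⟨ha0, ha1, hu, hv, hb0, hrd⟩ := coverB_levels hρY hmonoY hagree hRX hRY hM hβX hβY ha hcK hN0 hN1 hm hc.le
  rcases n with _ | n
  · rw [hPY0, hPX0, hPX0]; norm_num
  rw [hubClass_pow_offdiag hρY hmonoY hN hRY hM hPYoff hPYdiag hfY hβY hPY0 hPYs hTY (n + 1) (by omega) hm (by omega), max_eq_right zero_le_one, ← hagree 1 one_ne_zero,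
    hubClass_pow_offdiag hρX hmonoX hN hRX hM hPXoff hPXdiag hfX hβX hPX0 hPXs hTX (n + 1) (by omega) hm (by omega), max_eq_right zero_le_one,
    hubClass_pow_diag hρX hmonoX hN hRX hM hPXoff hPXdiag hfX hβX hPX0 hPXs hTX (n + 1) (by omega : 0 < m), hN1, hN0]
  have hsub := cover_T_sub_ge_deep hρX hρY hmonoY hagree htag hN hRX hRY hM hβX hβY ha hTX hTY hH hc.le hcK.le (n + 1) zero_lt_one hm (by rw [ha1]; exact hc.le) h3
  have htwo := coverB_T_ge_two hρX hmonoX hN hRX hM hβX ha hTX hH hc.le hcK.le (n + 1) (j := 0) hm (by rw [ha1]; exact hc.le) h3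
  rw [ha1] at hsub
  rw [ha0, ha1, hb0, sepH_zero_right hH (by omega : 1 ≤ n + 1), sepH_zero_right hH (by omega : 1 ≤ n + 1), show n + 1 - 1 = n by omega] at htwo
  have hρ1 := hρX 1
  have hρ0 := hρX 0
  have hmul := hubChain_H_mul hH (n + 1) (βX 1) c
  have key : (c + c * ρX 0 / ρX 1) * H (n + 1) (βX 1) c = c ^ (n + 1) - βX 1 ^ (n + 1) := by
    rw [hu]; rw [hu] at hmul; linear_combination (-1 : ℝ) * hmul
  have he0 : 0 ≤ c * ρY 0 / ρX 1 := div_nonneg (mul_nonneg hc.le (hρY 0).le) hρ1.le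
  have hsc : c * H (n + 1) (βY 1) c ≤ c ^ (n + 1) := by rw [hv]; exact coverB_scalar hH (n + 1) hc he0 hrd
  have e1 : c * H (n + 1) (βX 1) c - c * H (n + 1) (βY 1) c ≤ ρX 1 * TX (n + 1) 1 - ρX 1 * TY (n + 1) 1 := by
    have h := mul_le_mul_of_nonneg_left hsub hρ1.le
    have e : ρX 1 * (c * (1 / ρX 1) * (H (n + 1) (βX 1) c - H (n + 1) (βY 1) c)) = c * H (n + 1) (βX 1) c - c * H (n + 1) (βY 1) c := by field_simp
    rw [e, mul_sub] at h; exact h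
  -- `ρ_0·T^X(0) ≥ c(−c)ⁿ + r[H(u,c) − uⁿ]`, `c(−c)ⁿ + (−c)ⁿ⁺¹ = 0`, `uⁿ(u + r) = 0`
  have e2 : c * (-c) ^ n + (c * ρX 0 / ρX 1 * H (n + 1) (βX 1) c - c * ρX 0 / ρX 1 * βX 1 ^ n) ≤ ρX 0 * TX (n + 1) 0 := by
    have h := mul_le_mul_of_nonneg_left htwo hρ0.le
    have e : ρX 0 * (c * (1 / ρX 0) * (-c) ^ n + c * ((1 / ρX 1) * (H (n + 1) (βX 1) c - βX 1 ^ n)))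
        = c * (-c) ^ n + (c * ρX 0 / ρX 1 * H (n + 1) (βX 1) c - c * ρX 0 / ρX 1 * βX 1 ^ n) := by field_simp
    rw [e] at h; exact h
  have e' : c * (-c) ^ n + (-c) ^ (n + 1) = 0 := by rw [pow_succ]; ring
  have e3 : βX 1 ^ (n + 1) + c * ρX 0 / ρX 1 * βX 1 ^ n = 0 := by rw [pow_succ, hu]; ring
  have key' : c * H (n + 1) (βX 1) c + c * ρX 0 / ρX 1 * H (n + 1) (βX 1) c = c ^ (n + 1) - βX 1 ^ (n + 1) := by rw [← key]; ring
  simp only [one_mul]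
  rw [hb0]
  linarith [e1, e2, e', e3, key', hsc]

/-- **THE COVER IN THE RESIDUAL CONFIGURATION:** tag at rank `0`, start class at rank `1`, one particle each, `cM_0 = 1 + c`, at least three particles: `P_Yⁿ(1,1) ≤ P_Xⁿ(1,1) + P_Xⁿ(1,0)`
for every `n`. [ours] -/
theorem startClass_cover_pair (hρX : ∀ i, 0 < ρX i) (hmonoX : Monotone ρX) (hρY : ∀ i, 0 < ρY i) (hmonoY : Monotone ρY)
    (hagree : ∀ i, i ≠ 0 → ρX i = ρY i) (htag : ρX 0 ≤ ρY 0) (hN : ∀ i, 0 < N i) (hNge : ∀ i, 1 ≤ N i)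
    (hRX : ∀ k, RX k = ∑ i ∈ range k, N i * ρX i) (hRY : ∀ k, RY k = ∑ i ∈ range k, N i * ρY i) (hM : ∀ k, M k = ∑ i ∈ Ico k m, N i)
    (hPXoff : ∀ i j, i ≠ j → PX i j = c * N j * min 1 (ρX j / ρX i)) (hPXdiag : ∀ i, PX i i = 1 - ∑ j ∈ (range m).erase i, PX i j)
    (hPYoff : ∀ i j, i ≠ j → PY i j = c * N j * min 1 (ρY j / ρY i)) (hPYdiag : ∀ i, PY i i = 1 - ∑ j ∈ (range m).erase i, PY i j)
    (hfX : ∀ k i, fX k i = if i < k then ρX k else if i = k then -(RX k / N k) else 0)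
    (hfY : ∀ k i, fY k i = if i < k then ρY k else if i = k then -(RY k / N k) else 0)
    (hβX : ∀ k, βX k = 1 - c * (M k + RX k / ρX k)) (hβY : ∀ k, βY k = 1 - c * (M k + RY k / ρY k)) (ha : ∀ l, a l = 1 - c * M (l + 1))
    (hPX0 : ∀ i j, PnX 0 i j = if i = j then 1 else 0) (hPXs : ∀ n i j, PnX (n + 1) i j = ∑ l ∈ range m, PnX n i l * PX l j)
    (hPY0 : ∀ i j, PnY 0 i j = if i = j then 1 else 0) (hPYs : ∀ n i j, PnY (n + 1) i j = ∑ l ∈ range m, PnY n i l * PY l j)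
    (hTX : ∀ n j, TX n j = (1 - βX j ^ n) / RX m + ∑ k ∈ Ico (j + 1) m, (1 / RX k - 1 / RX (k + 1)) * (βX k ^ n - βX j ^ n))
    (hTY : ∀ n j, TY n j = (1 - βY j ^ n) / RY m + ∑ k ∈ Ico (j + 1) m, (1 / RY k - 1 / RY (k + 1)) * (βY k ^ n - βY j ^ n))
    (hc : 0 < c) (hcK : c * M 0 = 1 + c) (hN0 : N 0 = 1) (hN1 : N 1 = 1) (hm : 1 < m) (h3 : M 3 + 3 ≤ M 0) :
    ∀ n, PnY n 1 1 ≤ PnX n 1 1 + PnX n 1 0 := by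
  refine startClass_cover_of hρX hmonoX hρY hmonoY hagree htag hN hNge hRX hRY hM hPXoff hPXdiag hPYoff hPYdiag hβX hβY hPX0 hPXs hPY0 hPYs hc.le hcK.le
    one_ne_zero hm (by omega) ?_ ?_ ?_
  · intro n l hl hl1 hl0
    refine perStep_pow_le hρX hmonoX hρY hmonoY hagree htag hN hRX hRY hM hPXoff hPXdiag hPYoff hPYdiag hfX hfY hβX hβY ha hPX0 hPXs hPY0 hPYs hTX hTY hc.le hcK.le n
      hl hm (by omega) hl1 hl0 one_ne_zero ?_
    have hl2 : 2 ≤ l := by omega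
    have hmax : M (max (max l 1) 0 + 1) ≤ M 3 := by
      refine perStep_M_anti hN hM ?_
      rw [max_eq_left (Nat.zero_le _), max_eq_left (by omega : 1 ≤ l)]; omega
    linarith
  · exact coverB_I hρX hmonoX hρY hmonoY hagree htag hN hRX hRY hM hPXoff hPXdiag hPYoff hPYdiag hfX hfY hβX hβY ha hPX0 hPXs hPY0 hPYs hTX hTY hc hcK hN0 hN1 hm h3
  · exact coverB_II hρX hmonoX hρY hmonoY hagree htag hN hRX hRY hM hPXoff hPXdiag hPYoff hPYdiag hfX hfY hβX hβY ha hPX0 hPXs hPY0 hPYs hTX hTY hc hcK hN0 hN1 hm h3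

end Pair

end Summit.Ventures.LatticeQCDFlow.Scaling
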